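import Summits.QuantumFields.YangMills.Theorems.LuscherReductionTwistedTraceScalingFPWeightDetSmooth
import HarnessLib

/-!
# The Gaussian value of the Laplace integrals: `I_p(a) = ∫ exp(−a‖A_p w‖²/s²) dw = (πs²/a)^{3n/2}/√gramDet(p)` — no equal-dimension hypothesis
# (lane A of S-BASE, crux `TwistedTraceScaling` stmt-QuantumFields-20203, C4 INNER; design note `pub/ym-fleet/ym-luscher-20007-p1/COARSE-DESIGN.md` §23.12)

`…GaussianLinear` / `…GaussianPi` evaluated `∫ exp(−b‖Av‖²)` for injective `A` into a space OF THE SAME DIMENSION; the Laplace map `A_p : flat → LinkSpace` lands in the bigger link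
space.  THIS FILE removes the hypothesis (factor through the range, `LinearMap.normDet_codRestrict`):
* ★ `integral_exp_neg_mul_sq_norm_of_injective` (any codomain) and its flat-coordinate form ★ `integral_exp_neg_mul_sq_norm_pi'`;
* ★ `laplaceEucl_injective` — `T_p = A_p ∘ e` is injective for `p` near `0` (uniform coercivity, `…SliceCoerciveBased`);
* ★★ `laplaceIntegral_eq`: for `p` near `0`, `a > 0`, `s > 0`: `∫ exp(−a‖A_p w‖²/s²) dw = (πs²/a)^{(3n)/2}/√(gramDet p)` (`gramDet = normDet²`, `…FPWeightDetSmooth`).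
Plugging into `fpWeight_laplace_bounds` (p636367) and `exists_gramDet_sq_bound` (p637998) gives the explicit asymptotics of the Faddeev–Popov weight (§23.12).
HONEST FRAMING: textbook calculus for a stub of a child of the CONDITIONAL reduction route R2b1; no spectral claim; C4 OPEN; not a gap, not Clay.
-/

set_option autoImplicit false

noncomputable section

open MeasureTheory Filter Topology Real Module
open scoped BigOperators
open Literature.MathematicalPhysics.QuantumFieldTheory
open Literature.MathematicalPhysics.QuantumLattice

namespace Summit.QuantumFields.YangMills.Theorems.FemtoTransferGap.TwoLattice.ConstTube

open Summit.QuantumFields.YangMills.Theorems.FemtoTransferGap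
open Summit.QuantumFields.YangMills.Theorems.FemtoTransferGap.TwoLattice.Stiff (LinkSpace)

/-! ## §1 Gaussians of injective linear maps into any codomain -/

section General

variable {V W : Type*} [NormedAddCommGroup V] [InnerProductSpace ℝ V] [FiniteDimensional ℝ V] [MeasurableSpace V] [BorelSpace V]
  [NormedAddCommGroup W] [InnerProductSpace ℝ W]

/-- ★ `∫ exp(−b‖A v‖²) dv = (π/b)^{dim V/2} / normDet A` for an injective linear `A : V → W` (any `W`). [folklore] -/
theorem integral_exp_neg_mul_sq_norm_of_injective (A : V →ₗ[ℝ] W) (hA : Function.Injective A) {b : ℝ} (hb : 0 < b) :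
    ∫ v, Real.exp (-b * ‖A v‖ ^ 2) = (π / b) ^ (finrank ℝ V / 2 : ℝ) / A.normDet := by
  -- factor through the range
  set A' : V →ₗ[ℝ] (LinearMap.range A) := A.rangeRestrict with hA'
  have hnorm : ∀ v, ‖A v‖ = ‖A' v‖ := fun v => rfl
  have hinj : Function.Injective A' := fun v w h => hA (by
    have := congrArg (fun x : LinearMap.range A => (x : W)) h
    exact this)
  have hdim : finrank ℝ (LinearMap.range A) = finrank ℝ V := LinearMap.finrank_range_of_inj hA
  have hdet : A'.normDet = A.normDet := LinearMap.normDet_codRestrict (p := LinearMap.range A) (f := A) (fun c => LinearMap.mem_range_self A c)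
  simp_rw [hnorm]
  rw [integral_exp_neg_mul_sq_norm_comp_of_injective A' hinj hdim hb, hdet]

/-- ★ Flat-coordinate form: `∫ w, exp(−b‖A w‖²) = (π/b)^{(3|ι|)/2} / normDet(A ∘ euclToPi)` for `A ∘ euclToPi` injective (any codomain). [folklore] -/
theorem integral_exp_neg_mul_sq_norm_pi' (ι : Type*) [Fintype ι] (A : (ι → Fin 3 → ℝ) →ₗ[ℝ] W) (hA : Function.Injective (A ∘ₗ euclToPiₗ ι))
    {b : ℝ} (hb : 0 < b) :
    ∫ w, Real.exp (-b * ‖A w‖ ^ 2) ∂(volume : Measure (ι → Fin 3 → ℝ)) =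
      (π / b) ^ (finrank ℝ (EuclideanSpace ℝ (ι × Fin 3)) / 2 : ℝ) / (A ∘ₗ euclToPiₗ ι).normDet := by
  rw [← (volume_preserving_euclToPiM ι).integral_comp' (fun w => Real.exp (-b * ‖A w‖ ^ 2))]
  exact integral_exp_neg_mul_sq_norm_of_injective (A ∘ₗ euclToPiₗ ι) hA hb

end General

variable (L : ℕ) [NeZero L]

/-! ## §2 The Laplace integrals of the Faddeev–Popov weight -/

/-- ★ `T_p = A_p ∘ e` is injective for `p` near `0`. [folklore] -/
theorem laplaceEucl_injective : ∀ᶠ p : balancedSubmodule L × (Fin 3 → Fin 3 → ℝ) in 𝓝 0, Function.Injective (laplaceEucl L p) := by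
  obtain ⟨ε, hε, hC⟩ := exists_uniform_coercive_basedLin L
  have hball := Metric.ball_mem_nhds (0 : balancedSubmodule L × (Fin 3 → Fin 3 → ℝ)) hε
  filter_upwards [hball] with p hp
  rw [Metric.mem_ball, dist_zero_right] at hp
  intro v w h
  have hlin : laplaceEucl L p (v - w) = 0 := by rw [map_sub, h, sub_self]
  have h1 := hC p hp (flatLin L (euclToPiₗ (NzSite L) (v - w)))
  have h2 : (gaugeModes L).starProjection (basedLin L p (flatLin L (euclToPiₗ (NzSite L) (v - w)))) = 0 := hlin
  rw [h2, norm_zero, mul_zero] at h1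
  have h3 : flatLin L (euclToPiₗ (NzSite L) (v - w)) = 0 := norm_le_zero_iff.mp h1
  have h4 : euclToPiₗ (NzSite L) (v - w) = 0 := by
    have := congrArg (fun ξ : basedSubmodule L => ‖ξ‖) h3
    rw [norm_flatLin, norm_zero] at this
    exact norm_le_zero_iff.mp this.le
  exact sub_eq_zero.mp (euclToPi_injective L (by rw [h4, map_zero]))

/-- ★★ **THE GAUSSIAN VALUE OF THE LAPLACE INTEGRALS**: for `p` near `0`, `a > 0`, `s > 0`,
`∫ exp(−a‖A_p w‖²/s²) dw = (πs²/a)^{(3n)/2}/√(gramDet p)`. [folklore] -/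
theorem laplaceIntegral_eq : ∀ᶠ p : balancedSubmodule L × (Fin 3 → Fin 3 → ℝ) in 𝓝 0, ∀ {a s : ℝ}, 0 < a → 0 < s →
    ∫ w, Real.exp (-(a * ‖laplaceMap L p w‖ ^ 2 / s ^ 2)) ∂(volume : Measure (NzSite L → Fin 3 → ℝ)) =
      (π * s ^ 2 / a) ^ (finrank ℝ (EuclideanSpace ℝ (NzSite L × Fin 3)) / 2 : ℝ) / Real.sqrt (gramDet L p) := by
  filter_upwards [laplaceEucl_injective L] with p hp a s ha hs
  have hb : 0 < a / s ^ 2 := by positivity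
  have h := integral_exp_neg_mul_sq_norm_pi' (W := LinkSpace L) (NzSite L) (laplaceMap L p) hp hb
  have hfun : (fun w : NzSite L → Fin 3 → ℝ => Real.exp (-(a * ‖laplaceMap L p w‖ ^ 2 / s ^ 2))) = fun w => Real.exp (-(a / s ^ 2) * ‖laplaceMap L p w‖ ^ 2) := by
    funext w; congr 1; ring
  rw [hfun, h]
  have hsqrt : Real.sqrt (gramDet L p) = (laplaceEucl L p).normDet := by
    rw [gramDet_eq_normDet_sq, Real.sqrt_sq (LinearMap.normDet_nonneg _)]
  rw [hsqrt]
  congr 1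
  rw [show π / (a / s ^ 2) = π * s ^ 2 / a by field_simp]

end Summit.QuantumFields.YangMills.Theorems.FemtoTransferGap.TwoLattice.ConstTube

end
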